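import Summits.HodgeConjecture.HodgeConjecture.Theorems.K2E3BranchBSkewLineCharacterIntegral     -- ★ (K2E3-p04) brings ★ `F0P3cStCharTSTorusCompactPart.mem_unitsIntegers_iff`, ★ `K2E3BranchBSkewLineIntegrals` (`valued_invOf_two_apply`), the `HeisRing` chart
import Summits.HodgeConjecture.HodgeConjecture.Theorems.R90S1RamifiedFixedSkewShellGeometry       -- ★ (this seat) brings ★ `Liu2021…valued_galAdicCompletionMap_sub_lt_one_of_ramified` (`σ_w ≡ id mod 𝔪_w` at a ramified place)
import HarnessLib

/-!
# R90 · S1 ∕ U4Keys leaf (U4f-χ₁-ram-one-d0B) — A `σ`-FIXED UNIT ON WHICH `χ₁` IS NON-TRIVIAL, AT A TAME RAMIFIED PLACE: `hram` + `hdepth` + `e(w|v) = 2`, `|2|_w = 1` ⟹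
# `∃ b₀ ∈ Rˣ`, `σ b₀ = b₀`, `|b₀|_w = 1`, `χ₁(b₀) ≠ 1` (the letter `b₀` of ★∕📤 `R90S1RamifiedSkewSphereCharacterIntegral`)
# [NeukirchANT1999 Ch. I §9 Prop. (9.6), Ch. II §4; Keys1984 §5, §7 Thm (2) (d); PAPER-Z3-DepthZeroRamified §1 (R90-C10-p05 (g0), r01-screened)]

Cell `hodgecm-mathlib`, SLAB R90-TF, section S1 «Ch. 12 local», crux H413 = `stmt-HodgeConjecture-24833` (lane `--supports … --as helper`), route HCCMUnconditional; prover seat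
`hodgecm-mathlib-R90-C10-p05` (g0); socket of record S1#3′ = K2E3 leaf (U4f-χ₁-ram-one) ⊇ U4Keys :155 (depth 0, Branch B).  THEOREMS ONLY (no definition ∕ instance ∕ notation ∕
named fact ∕ `sorry`); ★-only imports.  FRAME (v1 spellings): `R := LocalRing L v`, `σ := conjLocal L c v`; `v` non-split (`hw`), `w ∣ v` RAMIFIED (`he`), `|2|_w = 1` (`h2w`,
`[Invertible (2 : R)]`); the :155 letters `hdepth` (depth zero) and `hram` (`χ₁` non-trivial on the integral units).

THE POINT.  The orthogonality trick on the skew line (★∕📤 `skewSphereIntegral_dite_chi_eq_zero_of_fixed_unit`) needs a `σ`-FIXED unit `b₀` of valuation one with `χ₁(b₀) ≠ 1`.  At an inert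
place none need exist (`χ₁` may be trivial on `𝒪_F^×`); at a RAMIFIED place the inertia acts trivially on the residue field — `|σ_w(y) − y|_w < 1` for `|y|_w ≤ 1`, ★
`valued_galAdicCompletionMap_sub_lt_one_of_ramified` — so for the unit-integer `u₀` with `χ₁(u₀) ≠ 1` given by `hram`, the fixed element `b₀ := ½(u₀ + σu₀)` satisfies
`|u₀ − b₀|_w = |½(u₀ − σu₀)|_w < 1`: `b₀` is a fixed unit of valuation one, `u₀⁻¹b₀` is a principal unit, and `χ₁(b₀) = χ₁(u₀)·χ₁(u₀⁻¹b₀) = χ₁(u₀) ≠ 1` (`hdepth`).  No residue fields.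
* **`exists_fixed_unit_apply_ne_one_ram`**.
HONEST LABEL.  HC_CM is proved only modulo the 7 printed citations (2 remaining named inputs: hLiu418 = `stmt-HodgeConjecture-24832`, h413 = `stmt-HodgeConjecture-24833`) until rung 0
closes; count-neutral — this file does NOT pay the leaf; no printed citation is discharged.

## References
* [NeukirchANT1999] J. Neukirch, *Algebraic Number Theory* (1999), Ch. I §9 Prop. (9.6) (inertia acts trivially on the residue field), Ch. II §4 Prop. (4.3).
* [Keys1984] D. Keys, *Principal series representations of special unitary groups over local fields*, Compositio Math. 51 (1984), §5, §7 Theorem (2) (d) p. 126.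
* [Rogawski1990] J. D. Rogawski, *Automorphic Representations of Unitary Groups in Three Variables*, Ann. of Math. Stud. 123 (1990), §12.2 (2) p. 173.
-/

set_option autoImplicit false
-- the mandated namespace has the single-problem summit's repeated segment (`HodgeConjecture.HodgeConjecture`)
set_option linter.dupNamespace false

noncomputable section

open NumberField IsDedekindDomain
open Literature.NumberTheory Literature.NumberTheory.Automorphic Literature.NumberTheory.Automorphic.UnitaryGroup
open Literature.NumberTheory.Automorphic.Liu2021.LemD1IndexedNonVacuityRamifiedConverse (valued_galAdicCompletionMap_sub_lt_one_of_ramified)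

namespace Summit.HodgeConjecture.HodgeConjecture.R90.S1

open Summit.HodgeConjecture.HodgeConjecture.Cruxes.H413
open Summit.HodgeConjecture.HodgeConjecture.Cruxes.H413.K2E3BranchBSkewUnitSign
open Summit.HodgeConjecture.HodgeConjecture.Cruxes.H413.K2E3BranchBSkewLineIntegrals

variable (L : Type) [Field L] [NumberField L] [IsCMField L] (v : HeightOneSpectrum (𝓞 ↥(maximalRealSubfield L)))
  (w : PlacesOver L v) (hw : IsCMField.complexConj L • w.1 = w.1)

include hw in
/-- **A `σ`-FIXED UNIT WITH `χ₁(b₀) ≠ 1` AT A TAME RAMIFIED PLACE.**  `v` non-split, `w ∣ v` ramified (`he`), `|2|_w = 1`; `χ₁` trivial on principal units (`hdepth`) and non-trivial on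
the integral units (`hram`).  Then `∃ b₀ ∈ Rˣ` with `σ b₀ = b₀`, `|b₀|_w = 1`, `χ₁(b₀) ≠ 1`: `b₀ = ½(u₀ + σu₀)` for the `u₀` of `hram`, using `|σ_w(y) − y|_w < 1` on `𝒪_w` (★
`valued_galAdicCompletionMap_sub_lt_one_of_ramified`) and `hdepth` on the principal unit `u₀⁻¹b₀`. [cite: NeukirchANT1999, Ch. I §9 Prop. (9.6)] [cite: Keys1984, §5, §7 Theorem (2) (d) p. 126] -/
theorem exists_fixed_unit_apply_ne_one_ram [Invertible (2 : LocalRing L v)] (he : v.asIdeal.ramificationIdx' w.1.asIdeal ≠ 1)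
    (h2w : Valued.v (2 : w.1.adicCompletion L) = 1) (χ₁ : (LocalRing L v)ˣ →* ℂˣ)
    (hdepth : ∀ u : (LocalRing L v)ˣ, (∀ w' : PlacesOver L v, Valued.v (((u : LocalRing L v) w') - 1) < 1) → χ₁ u = 1)
    (hram : ¬ ∀ u ∈ (Submonoid.pi Set.univ (fun w' : PlacesOver L v => (w'.1.adicCompletionIntegers L).toSubring.toSubmonoid)).units, χ₁ u = 1) :
    ∃ b₀ : (LocalRing L v)ˣ, conjLocal L (IsCMField.complexConj L) v (b₀ : LocalRing L v) = b₀ ∧ Valued.v ((b₀ : LocalRing L v) w) = 1 ∧ χ₁ b₀ ≠ 1 := by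
  haveI : Algebra.IsQuadraticExtension ↥(maximalRealSubfield L) L := IsCMField.isQuadraticExtension L
  obtain ⟨u₀, hu₀, hχ⟩ : ∃ u₀, u₀ ∈ (Submonoid.pi Set.univ
      (fun w' : PlacesOver L v => (w'.1.adicCompletionIntegers L).toSubring.toSubmonoid)).units ∧ χ₁ u₀ ≠ 1 := by
    by_contra h
    push Not at h
    exact hram h
  have hu1 : ∀ w', Valued.v ((u₀ : LocalRing L v) w') = 1 := (F0P3cStCharTSTorusCompactPart.mem_unitsIntegers_iff L v u₀).1 hu₀
  -- the fixed element `b = ½(u₀ + σu₀)`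
  set b : LocalRing L v := ⅟ (2 : LocalRing L v) * ((u₀ : LocalRing L v) + conjLocal L (IsCMField.complexConj L) v (u₀ : LocalRing L v)) with hb_def
  have hbfix : conjLocal L (IsCMField.complexConj L) v b = b := by
    rw [hb_def, map_mul, HeisRing.map_invOf_two (conjLocal L (IsCMField.complexConj L) v), map_add, conjLocal_conjLocal_cm L v, add_comm]
  -- `u₀ − b = ½(u₀ − σu₀)` has valuation `< 1` at `w` (inertia acts trivially mod `𝔪_w` at a ramified place)
  have hdiff : (u₀ : LocalRing L v) - b = ⅟ (2 : LocalRing L v) * ((u₀ : LocalRing L v) - conjLocal L (IsCMField.complexConj L) v (u₀ : LocalRing L v)) := by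
    calc (u₀ : LocalRing L v) - b
        = ⅟ (2 : LocalRing L v) * (2 * (u₀ : LocalRing L v)) - ⅟ (2 : LocalRing L v) * ((u₀ : LocalRing L v) + conjLocal L (IsCMField.complexConj L) v (u₀ : LocalRing L v)) := by
          rw [← mul_assoc, invOf_mul_self, one_mul]
      _ = ⅟ (2 : LocalRing L v) * ((u₀ : LocalRing L v) - conjLocal L (IsCMField.complexConj L) v (u₀ : LocalRing L v)) := by ring
  have hsub : Valued.v ((((u₀ : LocalRing L v) - b)) w) < 1 := by
    rw [hdiff, Pi.mul_apply, map_mul, valued_invOf_two_apply L v w h2w, one_mul, Pi.sub_apply,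
      conjLocal_apply_eq_of_smul_eq (IsCMField.complexConj L) (IsCMField.complexConj_ne_one L) v w hw, Valuation.map_sub_swap]
    exact valued_galAdicCompletionMap_sub_lt_one_of_ramified L (IsCMField.complexConj L) v (IsCMField.complexConj_ne_one L) w hw he _ (hu1 w).le
  -- hence `|b|_w = 1` and `b ∈ Rˣ`
  have hbv : Valued.v (b w) = 1 := by
    have h : b w = (u₀ : LocalRing L v) w - ((u₀ : LocalRing L v) - b) w := by rw [Pi.sub_apply]; ring
    rw [h, Valuation.map_sub_eq_of_lt_left _ (by rw [hu1 w]; exact hsub), hu1 w]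
  have hbU : IsUnit b := K2E3DepthZeroIwahoriCharacterCM.isUnit_of_apply_ne_zero L v w hw b (fun h0 => by rw [h0, map_zero] at hbv; exact zero_ne_one hbv)
  refine ⟨hbU.unit, by rw [IsUnit.unit_spec]; exact hbfix, by rw [IsUnit.unit_spec]; exact hbv, ?_⟩
  -- `χ₁(b̂) = χ₁(u₀) · χ₁(u₀⁻¹ b̂)` and the second factor is principal
  have hprin : χ₁ (u₀⁻¹ * hbU.unit) = 1 := by
    refine hdepth _ (forall_placesOver_of_apply L v w hw
      (P := fun w' => Valued.v ((((u₀⁻¹ * hbU.unit : (LocalRing L v)ˣ) : LocalRing L v) w') - 1) < 1) ?_)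
    have hu0 : (u₀ : LocalRing L v) w ≠ 0 := fun h0 => by have := hu1 w; rw [h0, map_zero] at this; exact zero_ne_one this
    have hinv : ((u₀⁻¹ : (LocalRing L v)ˣ) : LocalRing L v) w * (u₀ : LocalRing L v) w = 1 := by
      have h := congrFun u₀.inv_mul w
      rw [Pi.mul_apply, Pi.one_apply] at h
      exact h
    have huinv : ((u₀⁻¹ : (LocalRing L v)ˣ) : LocalRing L v) w = ((u₀ : LocalRing L v) w)⁻¹ := eq_inv_of_mul_eq_one_left hinv
    have hcalc : (((u₀⁻¹ * hbU.unit : (LocalRing L v)ˣ) : LocalRing L v) w) - 1 = ((u₀ : LocalRing L v) w)⁻¹ * (b - (u₀ : LocalRing L v)) w := by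
      rw [Units.val_mul, Pi.mul_apply, IsUnit.unit_spec, huinv, Pi.sub_apply, mul_sub, inv_mul_cancel₀ hu0]
    show Valued.v ((((u₀⁻¹ * hbU.unit : (LocalRing L v)ˣ) : LocalRing L v) w) - 1) < 1
    rw [hcalc, map_mul, map_inv₀, hu1 w, inv_one, one_mul, Pi.sub_apply, Valuation.map_sub_swap, ← Pi.sub_apply]
    exact hsub
  have hfac : hbU.unit = u₀ * (u₀⁻¹ * hbU.unit) := by rw [mul_inv_cancel_left]
  rw [hfac, map_mul, hprin, mul_one]
  exact hχ

end Summit.HodgeConjecture.HodgeConjecture.R90.S1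

end
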